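import Literature.MathematicalPhysics.KineticTheory.HardSphereEuler
import Literature.MathematicalPhysics.KineticTheory.FouriersLaw
import Literature.MathematicalPhysics.StatisticalMechanics.Crystallization
import Literature.MathematicalPhysics.QuantumManyBody.BoseEinsteinCondensation
import HarnessLib

/-!
# AtomisticToContinuum / BoseEinsteinCondensation — sub-problem statement (D-0017)

Moved out of `Summits/AtomisticToContinuum/Statement.lean` with the declaration text unchanged.
-/

/-- Conjunct `BoseEinsteinCondensation` of `AtomisticToContinuum`: the Literature statement
`Literature.MathematicalPhysics.QuantumManyBody.BoseGas.BoseEinsteinCondensation`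
(`Literature/MathematicalPhysics/QuantumManyBody/BoseEinsteinCondensation.lean`), imported not
restated — ground-state BEC (`λ_max` of the one-particle density matrix `≥ c N` for all large `N`,
`L = (N/ρ)^{1/3}`) for every repulsive finite-range radial pair potential at all sufficiently
small densities. [cite: LiebSeiringerSolovejYngvason2005, §1.2 (1.16)–(1.19) and Ch. 5 (5.1)–(5.2)]
[problem: hilbert6] -/
abbrev BoseEinsteinCondensation : Prop := Literature.MathematicalPhysics.QuantumManyBody.BoseGas.BoseEinsteinCondensation
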